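import Mathlib
import Literature.Analysis.FluidPDE.ClassicalSolution
import Literature.Analysis.FluidPDE.LerayHopf
import Literature.Analysis.FluidPDE.NSWave0
import Literature.Analysis.FluidPDE.TaoLocalisation
import Summits.NavierStokesRegularity.NavierStokesRegularity.Theses.L3TimeExponentPincer
import Summits.NavierStokesRegularity.NavierStokesRegularity.Theorems.L3TimeExponentPincerMorreyGrowth
import Summits.NavierStokesRegularity.NavierStokesRegularity.Theorems.L3TimeExponentPincerBallAverage
import Summits.NavierStokesRegularity.NavierStokesRegularity.Theorems.L3TimeExponentPincerJawSuperEuler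
import HarnessLib

/-!
# Scale-space localisation of crux `L3CascadeJaw` (stmt-NavierStokesRegularity-19499): the jaw lives below
# the Euler-eddy scale `r_E ∼ (T-t)^{2/5}`

Support file for the PARENT crux `L3CascadeJaw` of route `L3TimeExponentPincer` (cell ns-regularity-ideate, seat
ns-pincer-19499-p1 g2); companion of `L3TimeExponentPincerJawSuperEuler` (phase-space / SPEED localisation,
p471620).  There the sub-Euler-SPEED fluid (`|u| ≤ K (T-t)^{-3/5}`) was shown jaw-harmless; here the twin
statement in SCALE: the part of `u(t)` living at scales `≥ r_E(t) = K (T-t)^{2/5}` — concretely the top-hat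
average `A_ρ u(t)(x) = |B̄_ρ|⁻¹ ∫_{B̄(0,ρ)} u(t, x+z) dz` at `ρ = r_E(t)` — is jaw-harmless, so the crux is a
statement about the sub-Euler-eddy FLUCTUATION `u - A_{r_E} u` only.  Mechanism (energy level, elementary):
Jensen on the ball gives `|A_ρ u(x)|² ≤ |B̄_ρ|⁻¹ ∫_{B̄(x,ρ)}|u|² ≤ 2E₀/(V₁ρ³)` and `‖A_ρ u‖₂ ≤ ‖u‖₂`, hence
`‖A_ρ u(t)‖₃³ ≤ ‖A_ρ u‖_∞ ‖A_ρ u‖₂² ≤ (2E₀)^{3/2} (V₁ρ³)^{-1/2} ∝ (T-t)^{-3/5}` at `ρ = K(T-t)^{2/5}`, i.e.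
`‖A_{r_E} u(t)‖₃^q ≲ (T-t)^{-q/5}` — integrable at `T` iff `q < 5`, the whole jaw window (and `2/5` is the
finest admissible scale exponent at energy level).  All unconditional, kernel-checked:

* `continuous_ballAvg`, `enorm_ballAvg_sq_le_energy`, `lintegral_enorm_ballAvg_sq_le`,
  `lintegral_enorm_ballAvg_cube_le` — the top-hat average of a continuous finite-energy field: continuity, the sup
  bound, `‖A_ρ v‖₂ ≤ ‖v‖₂` (Jensen + Tonelli + translation invariance), `∫|A_ρ v|³ ≤ (|B̄_ρ|⁻¹‖v‖₂²)^{1/2} ‖v‖₂²`;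
* `l3cube_ballAvg_le`, `eddyScale_algebra`, `l3_ballAvg_rpow_le` — in the frame: `∫|A_ρ u(t)|³ ≤ √(2E₀/(ρ³V₁))·2E₀`
  and, at `ρ = K (T-t)^σ`, `‖A_ρ u(t)‖₃^q ≤ c (T-t)^{-(3σ/2)(q/3)}`;
* `jawClauseAt_iff_subEulerEddy` — for every frame solution, `K > 0`, scale exponent `σ ≤ 2/5`, `0 ≤ q < 5`:
  the clause at `q` for `u` ⟺ the clause at `q` for the fluctuation `u(t) - A_{K(T-t)^σ} u(t)`;
* `l3CascadeJaw_iff_subEulerEddy` — the crux BY NAME ⟺ "for every frame solution and every `q ∈ (4,5)` the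
  sub-Euler-eddy fluctuation `u - A_{K (T-t)^{2/5}} u` has `∫_{T₂}^T ‖·‖₃^q dt < ∞` on a final window" (any `K > 0`).

With p471620 the crux is thus localised to the EULER BOX of phase space: speeds above `U_E ∼ (T-t)^{-3/5}` and
scales below `r_E ∼ (T-t)^{2/5}` (`U_E r_E ∼ (T-t)^{-1/5} =` the jaw's `L³` rate; `U_E² r_E³ ∼ E₀`: one Euler eddy
carries the whole energy) — the typed form of the route's cascade heuristic, and the target a counterexample
must hit.

WHAT THIS IS NOT: not a claim about Navier–Stokes regularity or blow-up and no progress on the crux's open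
content; a reformulation landed `--supports stmt-NavierStokesRegularity-19499`.
-/

noncomputable section

namespace Summit.NavierStokesRegularity.NavierStokesRegularity.Theorems.L3TimeExponentPincerJawSubEulerEddy

open MeasureTheory Set Function Filter Metric Topology
open scoped ENNReal NNReal
open Literature.Analysis.FluidPDE
open Summit.NavierStokesRegularity.NavierStokesRegularity.Theses.L3TimeExponentPincer (L3CascadeJaw)
open Summit.NavierStokesRegularity.NavierStokesRegularity.Theorems.L3TimeExponentPincerMorreyGrowth (V₁)
open Summit.NavierStokesRegularity.NavierStokesRegularity.Theorems.L3TimeExponentPincerBallAverage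
  (enorm_avg_sq_le enorm_ballAvg_sq_le volume_closedBall_eq volume_closedBall_ne_zero)
open Summit.NavierStokesRegularity.NavierStokesRegularity.Theorems.L3TimeExponentPincerJawFullMorrey
  (eLpNorm_three_rpow_eq)
open Summit.NavierStokesRegularity.NavierStokesRegularity.Theorems.L3TimeExponentPincerDissipationAxis
  (add_rpow_le_two_rpow)
open Summit.NavierStokesRegularity.NavierStokesRegularity.Theorems.L3TimeExponentPincerJawSuperEuler
  (lintegral_low_rpow_lt_top)

/-! ## §1  The top-hat average of a continuous finite-energy field -/

/-- The top-hat average `x ↦ |B̄_ρ|⁻¹ ∫_{B̄(0,ρ)} v(x+z) dz` of a continuous field is continuous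
(parametric integral over a compact set). [folklore] -/
theorem continuous_ballAvg {v : (EuclideanSpace ℝ (Fin 3)) → (EuclideanSpace ℝ (Fin 3))} (hv : Continuous v) (ρ : ℝ) :
    Continuous fun x : (EuclideanSpace ℝ (Fin 3)) =>
      (volume (closedBall (0 : (EuclideanSpace ℝ (Fin 3))) ρ)).toReal⁻¹ • ∫ z in closedBall (0 : (EuclideanSpace ℝ (Fin 3))) ρ, v (x + z) := by
  have h : Continuous fun x : (EuclideanSpace ℝ (Fin 3)) => ∫ z in closedBall (0 : (EuclideanSpace ℝ (Fin 3))) ρ, v (x + z) :=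
    continuous_parametric_integral_of_continuous (f := fun x z => v (x + z))
      (hv.comp (continuous_fst.add continuous_snd)) (isCompact_closedBall (0 : (EuclideanSpace ℝ (Fin 3))) ρ)
  exact h.const_smul ((volume (closedBall (0 : (EuclideanSpace ℝ (Fin 3))) ρ)).toReal⁻¹ : ℝ)

/-- Sup bound of the top-hat average by the energy: `‖A_ρ v(x)‖² ≤ |B̄_ρ|⁻¹ ∫|v|²`. [folklore] -/
theorem enorm_ballAvg_sq_le_energy {v : (EuclideanSpace ℝ (Fin 3)) → (EuclideanSpace ℝ (Fin 3))} (hv : Continuous v) (x : (EuclideanSpace ℝ (Fin 3))) {ρ : ℝ} (hρ : 0 < ρ) :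
    ‖(volume (closedBall (0 : (EuclideanSpace ℝ (Fin 3))) ρ)).toReal⁻¹ • ∫ z in closedBall (0 : (EuclideanSpace ℝ (Fin 3))) ρ, v (x + z)‖ₑ ^ 2 ≤
      (volume (closedBall (0 : (EuclideanSpace ℝ (Fin 3))) ρ))⁻¹ * ∫⁻ y, ‖v y‖ₑ ^ 2 :=
  (enorm_ballAvg_sq_le hv x hρ).trans (mul_le_mul' le_rfl (setLIntegral_le_lintegral _ _))

/-- `L²`-contractivity of the top-hat average: `∫ |A_ρ v|² ≤ ∫ |v|²` (Jensen on the ball, Tonelli, translation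
invariance of Lebesgue measure). [folklore] -/
theorem lintegral_enorm_ballAvg_sq_le {v : (EuclideanSpace ℝ (Fin 3)) → (EuclideanSpace ℝ (Fin 3))} (hv : Continuous v) {ρ : ℝ} (hρ : 0 < ρ) :
    ∫⁻ x, ‖(volume (closedBall (0 : (EuclideanSpace ℝ (Fin 3))) ρ)).toReal⁻¹ • ∫ z in closedBall (0 : (EuclideanSpace ℝ (Fin 3))) ρ, v (x + z)‖ₑ ^ 2 ≤
      ∫⁻ x, ‖v x‖ₑ ^ 2 := by
  set K : Set (EuclideanSpace ℝ (Fin 3)) := closedBall (0 : (EuclideanSpace ℝ (Fin 3))) ρ with hK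
  have hK0 : volume K ≠ 0 := volume_closedBall_ne_zero 0 hρ
  have hKtop : volume K ≠ ⊤ := measure_closedBall_lt_top.ne
  have hpt : ∀ x : (EuclideanSpace ℝ (Fin 3)), ‖(volume K).toReal⁻¹ • ∫ z in K, v (x + z)‖ₑ ^ 2 ≤
      (volume K)⁻¹ * ∫⁻ z in K, ‖v (x + z)‖ₑ ^ 2 := fun x =>
    enorm_avg_sq_le hK0 hKtop ((hv.comp (continuous_const.add continuous_id)).measurable.aemeasurable)
  have hmeas2 : AEMeasurable (uncurry fun (x : (EuclideanSpace ℝ (Fin 3))) (z : (EuclideanSpace ℝ (Fin 3))) => ‖v (x + z)‖ₑ ^ 2)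
      (volume.prod (volume.restrict K)) :=
    ((hv.comp (continuous_fst.add continuous_snd)).measurable.enorm.pow_const 2).aemeasurable
  have hswap : ∫⁻ x, ∫⁻ z in K, ‖v (x + z)‖ₑ ^ 2 = ∫⁻ z in K, ∫⁻ x, ‖v (x + z)‖ₑ ^ 2 :=
    lintegral_lintegral_swap hmeas2
  have htrans : ∀ z : (EuclideanSpace ℝ (Fin 3)), ∫⁻ x, ‖v (x + z)‖ₑ ^ 2 = ∫⁻ x, ‖v x‖ₑ ^ 2 := fun z =>
    lintegral_add_right_eq_self (fun x => ‖v x‖ₑ ^ 2) z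
  calc ∫⁻ x, ‖(volume K).toReal⁻¹ • ∫ z in K, v (x + z)‖ₑ ^ 2
      ≤ ∫⁻ x, (volume K)⁻¹ * ∫⁻ z in K, ‖v (x + z)‖ₑ ^ 2 := lintegral_mono hpt
    _ = (volume K)⁻¹ * ∫⁻ x, ∫⁻ z in K, ‖v (x + z)‖ₑ ^ 2 :=
        lintegral_const_mul' _ _ (ENNReal.inv_ne_top.2 hK0)
    _ = (volume K)⁻¹ * ∫⁻ z in K, ∫⁻ x, ‖v x‖ₑ ^ 2 := by
        rw [hswap]
        congr 1
        exact lintegral_congr fun z => htrans z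
    _ = (volume K)⁻¹ * (∫⁻ x, ‖v x‖ₑ ^ 2) * volume K := by
        rw [setLIntegral_const, mul_assoc]
    _ = ∫⁻ x, ‖v x‖ₑ ^ 2 := by
        rw [mul_comm, ← mul_assoc, ENNReal.mul_inv_cancel hK0 hKtop, one_mul]

/-- `L³` bound of the top-hat average by the energy alone:
`∫|A_ρ v|³ ≤ (|B̄_ρ|⁻¹ ∫|v|²)^{1/2} · ∫|v|²` (`sup × L²`). [folklore] -/
theorem lintegral_enorm_ballAvg_cube_le {v : (EuclideanSpace ℝ (Fin 3)) → (EuclideanSpace ℝ (Fin 3))} (hv : Continuous v) {ρ : ℝ} (hρ : 0 < ρ) :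
    ∫⁻ x, ‖(volume (closedBall (0 : (EuclideanSpace ℝ (Fin 3))) ρ)).toReal⁻¹ • ∫ z in closedBall (0 : (EuclideanSpace ℝ (Fin 3))) ρ, v (x + z)‖ₑ ^ 3 ≤
      ((volume (closedBall (0 : (EuclideanSpace ℝ (Fin 3))) ρ))⁻¹ * ∫⁻ y, ‖v y‖ₑ ^ 2) ^ (2⁻¹ : ℝ) * ∫⁻ y, ‖v y‖ₑ ^ 2 := by
  set A : (EuclideanSpace ℝ (Fin 3)) → (EuclideanSpace ℝ (Fin 3)) := fun x =>
    (volume (closedBall (0 : (EuclideanSpace ℝ (Fin 3))) ρ)).toReal⁻¹ • ∫ z in closedBall (0 : (EuclideanSpace ℝ (Fin 3))) ρ, v (x + z) with hA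
  set S : ℝ≥0∞ := (volume (closedBall (0 : (EuclideanSpace ℝ (Fin 3))) ρ))⁻¹ * ∫⁻ y, ‖v y‖ₑ ^ 2 with hS
  have hsup : ∀ x, ‖A x‖ₑ ≤ S ^ (2⁻¹ : ℝ) := fun x => by
    have h : ‖A x‖ₑ ^ 2 ≤ S := enorm_ballAvg_sq_le_energy hv x hρ
    calc ‖A x‖ₑ = (‖A x‖ₑ ^ 2) ^ (2⁻¹ : ℝ) := by
          rw [← ENNReal.rpow_natCast, ← ENNReal.rpow_mul]; norm_num
      _ ≤ S ^ (2⁻¹ : ℝ) := ENNReal.rpow_le_rpow h (by norm_num)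
  have hmeasA : Measurable fun x => ‖A x‖ₑ ^ 2 :=
    (continuous_ballAvg hv ρ).measurable.enorm.pow_const 2
  calc ∫⁻ x, ‖A x‖ₑ ^ 3 = ∫⁻ x, ‖A x‖ₑ * ‖A x‖ₑ ^ 2 := lintegral_congr fun x => by rw [pow_succ']
    _ ≤ ∫⁻ x, S ^ (2⁻¹ : ℝ) * ‖A x‖ₑ ^ 2 := lintegral_mono fun x => mul_le_mul' (hsup x) le_rfl
    _ = S ^ (2⁻¹ : ℝ) * ∫⁻ x, ‖A x‖ₑ ^ 2 := lintegral_const_mul _ hmeasA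
    _ ≤ S ^ (2⁻¹ : ℝ) * ∫⁻ y, ‖v y‖ₑ ^ 2 := mul_le_mul' le_rfl (lintegral_enorm_ballAvg_sq_le hv hρ)

/-! ## §2  The frame: `‖A_ρ u(t)‖₃³ ≤ √(2E₀/(ρ³V₁)) · 2E₀`, and the Euler-eddy scale `ρ = K (T-t)^σ` -/

/-- In the frame (energy `≤ E₀ = E(u 0)` on `[0,T]`): `∫|A_ρ u(t)|³ ≤ √(2E₀/(ρ³ V₁)) · 2E₀` at every
`t ∈ [0,T)`, `V₁ = |B_1|`. -/
theorem l3cube_ballAvg_le {ν T : ℝ} (hν : 0 < ν)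
    {u : ℝ → (EuclideanSpace ℝ (Fin 3)) → (EuclideanSpace ℝ (Fin 3))} {p : ℝ → (EuclideanSpace ℝ (Fin 3)) → ℝ}
    (hcl : IsClassicalNSSolutionOn (Ico 0 T) ν 0 u p) (hLH : IsLerayHopfOn T ν 0 (u 0) u)
    {ρ : ℝ} (hρ : 0 < ρ) {t : ℝ} (ht : t ∈ Ico 0 T) :
    ∫⁻ x, ‖(volume (closedBall (0 : (EuclideanSpace ℝ (Fin 3))) ρ)).toReal⁻¹ • ∫ z in closedBall (0 : (EuclideanSpace ℝ (Fin 3))) ρ, u t (x + z)‖ₑ ^ 3 ≤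
      ENNReal.ofReal (Real.sqrt (2 * VectorCalculus.kineticEnergy (u 0) / (ρ ^ 3 * V₁)) *
        (2 * VectorCalculus.kineticEnergy (u 0))) := by
  set E₀ : ℝ := VectorCalculus.kineticEnergy (u 0) with hE₀
  have hE₀0 : 0 ≤ E₀ := by rw [hE₀]; exact kineticEnergy_nonneg _
  have hE := hLH.lintegral_enorm_sq_le hν.le (Ico_subset_Icc_self ht)
  have hcont : Continuous (u t) := (hcl.contDiff_velocity ht).continuous
  have hV : 0 < V₁ := by
    rw [V₁]
    exact ENNReal.toReal_pos (measure_ball_pos volume (0 : (EuclideanSpace ℝ (Fin 3))) one_pos).ne' measure_ball_lt_top.ne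
  have hρV : 0 < ρ ^ 3 * V₁ := by positivity
  have hvol : (volume (closedBall (0 : (EuclideanSpace ℝ (Fin 3))) ρ))⁻¹ = ENNReal.ofReal ((ρ ^ 3 * V₁)⁻¹) := by
    rw [volume_closedBall_eq 0 hρ, ENNReal.ofReal_inv_of_pos hρV]
  calc ∫⁻ x, ‖(volume (closedBall (0 : (EuclideanSpace ℝ (Fin 3))) ρ)).toReal⁻¹ • ∫ z in closedBall (0 : (EuclideanSpace ℝ (Fin 3))) ρ, u t (x + z)‖ₑ ^ 3
      ≤ ((volume (closedBall (0 : (EuclideanSpace ℝ (Fin 3))) ρ))⁻¹ * ∫⁻ y, ‖u t y‖ₑ ^ 2) ^ (2⁻¹ : ℝ) * ∫⁻ y, ‖u t y‖ₑ ^ 2 :=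
        lintegral_enorm_ballAvg_cube_le hcont hρ
    _ ≤ ((volume (closedBall (0 : (EuclideanSpace ℝ (Fin 3))) ρ))⁻¹ * ENNReal.ofReal (2 * E₀)) ^ (2⁻¹ : ℝ) * ENNReal.ofReal (2 * E₀) :=
        mul_le_mul' (ENNReal.rpow_le_rpow (mul_le_mul' le_rfl hE) (by norm_num)) hE
    _ = ENNReal.ofReal (Real.sqrt (2 * E₀ / (ρ ^ 3 * V₁)) * (2 * E₀)) := by
        rw [hvol, ← ENNReal.ofReal_mul (inv_nonneg.2 hρV.le),
          ENNReal.ofReal_rpow_of_nonneg (by positivity) (by norm_num),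
          ← ENNReal.ofReal_mul (Real.rpow_nonneg (by positivity) _), Real.sqrt_eq_rpow]
        congr 2
        rw [inv_mul_eq_div]
        norm_num

/-- Scale algebra at the Euler-eddy scale: for `s > 0`, `K > 0`, `V > 0`, `E ≥ 0`,
`√(2E/((K s^σ)³ V)) · 2E = (√(2E/(K³V)) · 2E) · s^{-(3σ/2)}`. -/
theorem eddyScale_algebra {s K V E σ : ℝ} (hs : 0 < s) (hK : 0 < K) (hV : 0 < V) (hE : 0 ≤ E) :
    Real.sqrt (2 * E / ((K * s ^ σ) ^ 3 * V)) * (2 * E) =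
      Real.sqrt (2 * E / (K ^ 3 * V)) * (2 * E) * s ^ (-(3 * σ / 2)) := by
  have hsσ : 0 < s ^ σ := Real.rpow_pos_of_pos hs σ
  have h3 : (s ^ σ) ^ 3 = s ^ (3 * σ) := by
    rw [← Real.rpow_natCast, ← Real.rpow_mul hs.le]; ring_nf
  have hsplit : 2 * E / ((K * s ^ σ) ^ 3 * V) = 2 * E / (K ^ 3 * V) * s ^ (-(3 * σ)) := by
    rw [mul_pow, h3, Real.rpow_neg hs.le]
    field_simp
  have hsq : Real.sqrt (s ^ (-(3 * σ))) = s ^ (-(3 * σ / 2)) := by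
    rw [Real.sqrt_eq_rpow, ← Real.rpow_mul hs.le]; ring_nf
  rw [hsplit, Real.sqrt_mul (by positivity), hsq]
  ring

/-- **The Euler-eddy average is jaw-harmless, quantitatively.**  At `ρ = K (T-t)^σ` (`K > 0`, any `σ`) and every
`t ∈ [0,T)`, for `q ≥ 0`:
`‖A_ρ u(t)‖₃^q ≤ (√(2E₀/(K³V₁))·2E₀)^{q/3} · (T-t)^{-(3σ/2)(q/3)}` (an explicit, time-measurable majorant). -/
theorem l3_ballAvg_rpow_le {ν T : ℝ} (hν : 0 < ν)
    {u : ℝ → (EuclideanSpace ℝ (Fin 3)) → (EuclideanSpace ℝ (Fin 3))} {p : ℝ → (EuclideanSpace ℝ (Fin 3)) → ℝ}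
    (hcl : IsClassicalNSSolutionOn (Ico 0 T) ν 0 u p) (hLH : IsLerayHopfOn T ν 0 (u 0) u)
    {K : ℝ} (hK : 0 < K) (σ : ℝ) {q : ℝ} (hq0 : 0 ≤ q) {t : ℝ} (ht : t ∈ Ico 0 T) :
    eLpNorm (fun x => (volume (closedBall (0 : (EuclideanSpace ℝ (Fin 3))) (K * (T - t) ^ σ))).toReal⁻¹ •
        ∫ z in closedBall (0 : (EuclideanSpace ℝ (Fin 3))) (K * (T - t) ^ σ), u t (x + z)) 3 volume ^ q ≤
      ENNReal.ofReal ((Real.sqrt (2 * VectorCalculus.kineticEnergy (u 0) / (K ^ 3 * V₁)) *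
          (2 * VectorCalculus.kineticEnergy (u 0))) ^ (q / 3) * (T - t) ^ (-((3 * σ / 2) * (q / 3)))) := by
  set E₀ : ℝ := VectorCalculus.kineticEnergy (u 0) with hE₀
  have hE₀0 : 0 ≤ E₀ := by rw [hE₀]; exact kineticEnergy_nonneg _
  have hs : 0 < T - t := sub_pos.2 ht.2
  have hρ : 0 < K * (T - t) ^ σ := mul_pos hK (Real.rpow_pos_of_pos hs σ)
  have hV : 0 < V₁ := by
    rw [V₁]
    exact ENNReal.toReal_pos (measure_ball_pos volume (0 : (EuclideanSpace ℝ (Fin 3))) one_pos).ne' measure_ball_lt_top.ne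
  have hc : 0 ≤ Real.sqrt (2 * E₀ / (K ^ 3 * V₁)) * (2 * E₀) := by positivity
  have hq3 : 0 ≤ q / 3 := by positivity
  rw [eLpNorm_three_rpow_eq]
  calc (∫⁻ x, ‖(volume (closedBall (0 : (EuclideanSpace ℝ (Fin 3))) (K * (T - t) ^ σ))).toReal⁻¹ •
          ∫ z in closedBall (0 : (EuclideanSpace ℝ (Fin 3))) (K * (T - t) ^ σ), u t (x + z)‖ₑ ^ 3) ^ (q / 3)
      ≤ (ENNReal.ofReal (Real.sqrt (2 * E₀ / ((K * (T - t) ^ σ) ^ 3 * V₁)) * (2 * E₀))) ^ (q / 3) :=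
        ENNReal.rpow_le_rpow (l3cube_ballAvg_le hν hcl hLH hρ ht) hq3
    _ = ENNReal.ofReal ((Real.sqrt (2 * E₀ / (K ^ 3 * V₁)) * (2 * E₀)) ^ (q / 3) *
          (T - t) ^ (-((3 * σ / 2) * (q / 3)))) := by
        rw [eddyScale_algebra hs hK hV hE₀0, ENNReal.ofReal_rpow_of_nonneg
          (mul_nonneg hc (Real.rpow_nonneg hs.le _)) hq3, Real.mul_rpow hc (Real.rpow_nonneg hs.le _),
          ← Real.rpow_mul hs.le, neg_mul]

/-! ## §3  The clause ⟺ the clause for the sub-Euler-eddy fluctuation -/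

/-- **Scale-space localisation of the clause.**  For a frame solution, `K > 0`, a scale exponent `σ ≤ 2/5` and
`0 ≤ q < 5`: `∫_{T₂}^T ‖u(t)‖₃^q dt < ∞` on some final window ⟺ `∫_{T₂}^T ‖u(t) - A_{K(T-t)^σ} u(t)‖₃^q dt < ∞`
on some final window (Minkowski both ways; the average contributes `≲ (T-t)^{-(3σ/2)(q/3)}`, integrable since
`(3σ/2)(q/3) ≤ q/5 < 1`).  `σ = 2/5` (the Euler-eddy scale) is the finest admissible scale at energy level. -/
theorem jawClauseAt_iff_subEulerEddy {ν T : ℝ} (hν : 0 < ν)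
    {u : ℝ → (EuclideanSpace ℝ (Fin 3)) → (EuclideanSpace ℝ (Fin 3))} {p : ℝ → (EuclideanSpace ℝ (Fin 3)) → ℝ}
    (hcl : IsClassicalNSSolutionOn (Ico 0 T) ν 0 u p) (hLH : IsLerayHopfOn T ν 0 (u 0) u)
    {K : ℝ} (hK : 0 < K) {σ : ℝ} (hσ : σ ≤ 2 / 5) {q : ℝ} (hq0 : 0 ≤ q) (hq5 : q < 5) :
    (∃ T₂ ∈ Ioo 0 T, (∫⁻ t in Ioo T₂ T, eLpNorm (u t) 3 volume ^ q) < ⊤) ↔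
      ∃ T₂ ∈ Ioo 0 T, (∫⁻ t in Ioo T₂ T,
        eLpNorm (fun x => u t x - (volume (closedBall (0 : (EuclideanSpace ℝ (Fin 3))) (K * (T - t) ^ σ))).toReal⁻¹ •
          ∫ z in closedBall (0 : (EuclideanSpace ℝ (Fin 3))) (K * (T - t) ^ σ), u t (x + z)) 3 volume ^ q) < ⊤ := by
  set E₀ : ℝ := VectorCalculus.kineticEnergy (u 0) with hE₀
  -- the averaged field and its explicit majorant
  set A : ℝ → (EuclideanSpace ℝ (Fin 3)) → (EuclideanSpace ℝ (Fin 3)) := fun t x => (volume (closedBall (0 : (EuclideanSpace ℝ (Fin 3))) (K * (T - t) ^ σ))).toReal⁻¹ •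
    ∫ z in closedBall (0 : (EuclideanSpace ℝ (Fin 3))) (K * (T - t) ^ σ), u t (x + z) with hA
  set c : ℝ := (Real.sqrt (2 * E₀ / (K ^ 3 * V₁)) * (2 * E₀)) ^ (q / 3) with hc
  set low : ℝ → ℝ≥0∞ := fun t => ENNReal.ofReal (c * (T - t) ^ (-((3 * σ / 2) * (q / 3)))) with hlow
  have hlow_meas : Measurable low := by
    rw [hlow]
    exact (measurable_const.mul ((measurable_const.sub measurable_id).pow_const _)).ennreal_ofReal
  have hθ : 3 * σ / 2 ≤ 3 / 5 := by linarith
  have hlow_fin : ∀ {T₂ : ℝ}, T₂ < T → ∫⁻ t in Ioo T₂ T, low t < ⊤ := fun hT₂ =>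
    lintegral_low_rpow_lt_top hT₂ hθ hq0 hq5
  have hAq : ∀ t ∈ Ico 0 T, eLpNorm (A t) 3 volume ^ q ≤ low t := fun t ht =>
    l3_ballAvg_rpow_le hν hcl hLH hK σ hq0 ht
  have hmeas_u : ∀ t ∈ Ico 0 T, AEStronglyMeasurable (u t) volume := fun t ht =>
    (hcl.contDiff_velocity ht).continuous.aestronglyMeasurable
  have hmeas_A : ∀ t ∈ Ico 0 T, AEStronglyMeasurable (A t) volume := fun t ht =>
    (continuous_ballAvg (hcl.contDiff_velocity ht).continuous _).aestronglyMeasurable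
  have h2q : (2 : ℝ≥0∞) ^ q ≠ ⊤ := ENNReal.rpow_ne_top_of_nonneg hq0 ENNReal.ofNat_ne_top
  constructor
  · rintro ⟨T₂, hT₂, hfin⟩
    refine ⟨T₂, hT₂, ?_⟩
    have hpt : ∀ t ∈ Ioo T₂ T, eLpNorm (fun x => u t x - A t x) 3 volume ^ q ≤
        (2 : ℝ≥0∞) ^ q * (eLpNorm (u t) 3 volume ^ q + low t) := by
      intro t ht
      have ht' : t ∈ Ico 0 T := ⟨(hT₂.1.trans ht.1).le, ht.2⟩
      have hsub : eLpNorm (fun x => u t x - A t x) 3 volume ≤ eLpNorm (u t) 3 volume + eLpNorm (A t) 3 volume :=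
        eLpNorm_sub_le (hmeas_u t ht') (hmeas_A t ht') (by norm_num)
      calc eLpNorm (fun x => u t x - A t x) 3 volume ^ q
          ≤ (eLpNorm (u t) 3 volume + eLpNorm (A t) 3 volume) ^ q := ENNReal.rpow_le_rpow hsub hq0
        _ ≤ (2 : ℝ≥0∞) ^ q * (eLpNorm (u t) 3 volume ^ q + eLpNorm (A t) 3 volume ^ q) :=
            add_rpow_le_two_rpow _ _ hq0
        _ ≤ (2 : ℝ≥0∞) ^ q * (eLpNorm (u t) 3 volume ^ q + low t) := by
            gcongr
            exact hAq t ht'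
    calc ∫⁻ t in Ioo T₂ T, eLpNorm (fun x => u t x - A t x) 3 volume ^ q
        ≤ ∫⁻ t in Ioo T₂ T, (2 : ℝ≥0∞) ^ q * (eLpNorm (u t) 3 volume ^ q + low t) :=
          setLIntegral_mono' measurableSet_Ioo hpt
      _ = (2 : ℝ≥0∞) ^ q * ((∫⁻ t in Ioo T₂ T, eLpNorm (u t) 3 volume ^ q) + ∫⁻ t in Ioo T₂ T, low t) := by
          rw [lintegral_const_mul' _ _ h2q, lintegral_add_right _ hlow_meas]
      _ < ⊤ := ENNReal.mul_lt_top (lt_top_iff_ne_top.2 h2q)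
          (ENNReal.add_lt_top.2 ⟨hfin, hlow_fin hT₂.2⟩)
  · rintro ⟨T₂, hT₂, hfin⟩
    refine ⟨T₂, hT₂, ?_⟩
    have hpt : ∀ t ∈ Ioo T₂ T, eLpNorm (u t) 3 volume ^ q ≤
        (2 : ℝ≥0∞) ^ q * (eLpNorm (fun x => u t x - A t x) 3 volume ^ q + low t) := by
      intro t ht
      have ht' : t ∈ Ico 0 T := ⟨(hT₂.1.trans ht.1).le, ht.2⟩
      have hdecomp : u t = (fun x => u t x - A t x) + A t := by
        funext x; simp
      have hadd : eLpNorm (u t) 3 volume ≤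
          eLpNorm (fun x => u t x - A t x) 3 volume + eLpNorm (A t) 3 volume := by
        conv_lhs => rw [hdecomp]
        exact eLpNorm_add_le ((hmeas_u t ht').sub (hmeas_A t ht')) (hmeas_A t ht') (by norm_num)
      calc eLpNorm (u t) 3 volume ^ q
          ≤ (eLpNorm (fun x => u t x - A t x) 3 volume + eLpNorm (A t) 3 volume) ^ q :=
            ENNReal.rpow_le_rpow hadd hq0
        _ ≤ (2 : ℝ≥0∞) ^ q * (eLpNorm (fun x => u t x - A t x) 3 volume ^ q + eLpNorm (A t) 3 volume ^ q) :=
            add_rpow_le_two_rpow _ _ hq0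
        _ ≤ (2 : ℝ≥0∞) ^ q * (eLpNorm (fun x => u t x - A t x) 3 volume ^ q + low t) := by
            gcongr
            exact hAq t ht'
    calc ∫⁻ t in Ioo T₂ T, eLpNorm (u t) 3 volume ^ q
        ≤ ∫⁻ t in Ioo T₂ T, (2 : ℝ≥0∞) ^ q * (eLpNorm (fun x => u t x - A t x) 3 volume ^ q + low t) :=
          setLIntegral_mono' measurableSet_Ioo hpt
      _ = (2 : ℝ≥0∞) ^ q *
            ((∫⁻ t in Ioo T₂ T, eLpNorm (fun x => u t x - A t x) 3 volume ^ q) + ∫⁻ t in Ioo T₂ T, low t) := by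
          rw [lintegral_const_mul' _ _ h2q, lintegral_add_right _ hlow_meas]
      _ < ⊤ := ENNReal.mul_lt_top (lt_top_iff_ne_top.2 h2q)
          (ENNReal.add_lt_top.2 ⟨hfin, hlow_fin hT₂.2⟩)

/-! ## §4  The crux BY NAME ⟺ its sub-Euler-eddy form -/

/-- **`L3CascadeJaw` ⟺ the jaw of the sub-Euler-eddy fluctuation.**  For any fixed `K > 0`: the crux holds iff
for every `q ∈ (4,5)` and every frame solution the fluctuation `u(t) - A_{K (T-t)^{2/5}} u(t)` below the
Euler-eddy scale has `∫_{T₂}^T ‖·‖₃^q dt < ∞` on a final window. -/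
theorem l3CascadeJaw_iff_subEulerEddy {K : ℝ} (hK : 0 < K) :
    L3CascadeJaw ↔
      ∀ q : ℝ, 4 < q → q < 5 → ∀ (ν T : ℝ), 0 < ν → 0 < T →
        ∀ (u : ℝ → (EuclideanSpace ℝ (Fin 3)) → (EuclideanSpace ℝ (Fin 3))) (p : ℝ → (EuclideanSpace ℝ (Fin 3)) → ℝ),
          IsClassicalNSSolutionOn (Ico 0 T) ν 0 u p → IsLerayHopfOn T ν 0 (u 0) u →
          HasRapidSpatialDecay (u 0) →
          ∃ T₂ ∈ Ioo 0 T, (∫⁻ t in Ioo T₂ T,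
            eLpNorm (fun x => u t x - (volume (closedBall (0 : (EuclideanSpace ℝ (Fin 3))) (K * (T - t) ^ (2 / 5 : ℝ)))).toReal⁻¹ •
              ∫ z in closedBall (0 : (EuclideanSpace ℝ (Fin 3))) (K * (T - t) ^ (2 / 5 : ℝ)), u t (x + z)) 3 volume ^ q) < ⊤ := by
  unfold L3CascadeJaw
  constructor
  · intro h q hq4 hq5 ν T hν hT u p hcl hLH hdec
    exact (jawClauseAt_iff_subEulerEddy hν hcl hLH hK le_rfl (by linarith) hq5).1
      (h q hq4 hq5 ν T hν hT u p hcl hLH hdec)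
  · intro h q hq4 hq5 ν T hν hT u p hcl hLH hdec
    exact (jawClauseAt_iff_subEulerEddy hν hcl hLH hK le_rfl (by linarith) hq5).2
      (h q hq4 hq5 ν T hν hT u p hcl hLH hdec)

end Summit.NavierStokesRegularity.NavierStokesRegularity.Theorems.L3TimeExponentPincerJawSubEulerEddy

end
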